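import Mathlib
import Literature.Combinatorics.Enumerative.AperyNumbers
import Literature.Combinatorics.Enumerative.AperyNumbersZetaTwo
import HarnessLib

/-!
# Lucas congruences for the Apéry numbers (Gessel 1982) and the sums `A_{r,s}(n) = Σ_k C(n,k)^r C(n+k,k)^s`

Topic `Literature/Combinatorics/Enumerative`.  Everything in this file is PROVED (no named facts).

## Source, as printed — I. Gessel, *Some congruences for Apéry numbers*, J. Number Theory **14** (1982)
362–368 [Gessel1982] (held text `paper:doi-10-1016-0022-314x-82-90071-3`, p. 363):

«THEOREM 1. For all primes `p`, `a_{n₀ + p n₁ + ⋯ + p^s n_s} ≡ a_{n₀} a_{n₁} ⋯ a_{n_s} (mod p)`, where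
`0 ≤ nᵢ < p`.»  Here `a_n = Σ_{k=0}^{n} C(n,k)² C(n+k,k)²` are the Apéry numbers `1, 5, 73, 1445, 33001, …`
(the tree's `AperyNumbers.aperyNumber`).  Gessel's proof (p. 363): «We shall need Lucas's congruence
`C(a+pb, c+pd) ≡ C(a,c) C(b,d) (mod p)`, where `0 ≤ a, c < p`, and the easily proved variant
`C(a+pb+c+pd, c+pd) ≡ C(a+c, c) C(b+d, d) (mod p)`.  Then for `0 ≤ m < p` we have
`a_{m+pn} = Σ_{i,j} C(m+pn, i+pj)² C(m+pn+i+pj, i+pj)² ≡ Σ_{i,j} C(m,i)² C(n,j)² C(m+i,i)² C(n+j,j)²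
= a_m a_n (mod p)`, and the theorem follows by induction.»

The same computation, verbatim, proves the Lucas congruences for every sum
`A_{r,s}(n) = Σ_{k ≥ 0} C(n,k)^r C(n+k,k)^s` with `r ≥ 1`, `s ≥ 0` (the family is displayed as (eq. A_{r,s})
in A. Malik, A. Straub, *Divisibility properties of sporadic Apéry-like numbers*, Res. Number Theory **2**
(2016) [MalikStraub2016] §3, held text `paper:arxiv-1508.00297` p. 6: «the Lucas congruences … in fact hold
for the family of generalized Apéry sequences `A_{r,s}(n) = Σ_k C(n,k)^r C(n+k,k)^s` with `r` and `s`
positive integers»; `A_{2,2}` = Apéry's `ζ(3)` numbers, `A_{2,1}` = Apéry's `ζ(2)` numbers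
`1, 3, 19, 147, …` = the tree's `AperyNumbersZetaTwo.apery2Number`, `A_{1,1}` = central Delannoy numbers,
`A_{r,0}` = Franel-type sums).  We formalise the general statement and specialise.

## What is formalised (everything PROVED)

* `genApery r s n = Σ_{k ≤ n} C(n,k)^r C(n+k,k)^s`; `genApery_two_two : genApery 2 2 n = aperyNumber n`,
  `genApery_two_one : genApery 2 1 n = apery2Number n`.
* the two Lucas ingredients in `ZMod p` (from Mathlib's `Choose.choose_modEq_choose_mod_mul_choose_div_nat`):
  `cast_choose_digit : C(kp+m, ip+j) = C(k,i) C(m,j)` and Gessel's «variant»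
  `cast_choose_shift_digit : C(kp+m+ip+j, ip+j) = C(k+i,i) C(m+j,j)` for digits `m, j < p`
  (both sides vanish when `m + j ≥ p`).
* **`genApery_modEq_mul`** — the one-digit step `A_{r,s}(kp+m) ≡ A_{r,s}(k) A_{r,s}(m) (mod p)` for
  `m < p`, `r ≥ 1`; **`genApery_modEq_prod_digits`** — the full Lucas congruence
  `A_{r,s}(n) ≡ ∏_{d ∈ digits_p n} A_{r,s}(d) (mod p)`.
* **`aperyNumber_modEq_mul`, `aperyNumber_modEq_prod_digits`** = Gessel's Theorem 1 as printed;
  `apery2Number_modEq_mul`, `apery2Number_modEq_prod_digits` = the `ζ(2)` companion.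

Not covered: Gessel's Theorems 2–4 (non-periodicity mod `p > 3`, `a_{pn} ≡ a_n (mod p³)`, the `mod p²`
shifts), the sporadic Apéry-like sequences of [MalikStraub2016] Thm 3.1 beyond the `A_{r,s}` family, and
prime-power extensions.  Nearest existing declarations (used, not restated): `AperyNumbers.aperyNumber`,
`AperyNumbersZetaTwo.apery2Number`, Mathlib `Choose.choose_modEq_choose_mod_mul_choose_div_nat` (Lucas).
-/

namespace Literature.Combinatorics.Enumerative.AperyLucasCongruences

open Finset

/-! ## The generalized Apéry sums -/

/-- The generalized Apéry sum `A_{r,s}(n) = Σ_{k=0}^{n} C(n,k)^r C(n+k,k)^s`.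
[cite: MalikStraub2016, §3 (eq. A_{r,s})] -/
def genApery (r s n : ℕ) : ℕ := ∑ k ∈ range (n + 1), n.choose k ^ r * (n + k).choose k ^ s

/-- `A_{2,2}(n)` is the Apéry number `Σ_k C(n,k)² C(n+k,k)²` of the tree. [cite: Gessel1982, (1)] -/
theorem genApery_two_two (n : ℕ) : genApery 2 2 n = AperyNumbers.aperyNumber n := by
  simp [genApery, AperyNumbers.aperyNumber, AperyNumbers.aperyTerm]

/-- `A_{2,1}(n)` is Apéry's `ζ(2)` number `Σ_k C(n,k)² C(n+k,k)` of the tree.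
[cite: MalikStraub2016, §3 (after eq. A_{r,s})] -/
theorem genApery_two_one (n : ℕ) : genApery 2 1 n = AperyNumbersZetaTwo.apery2Number n := by
  simp [genApery, AperyNumbersZetaTwo.apery2Number, AperyNumbersZetaTwo.apery2Term]

/-- `A_{r,s}(0) = 1`. [cite: Gessel1982, Thm 1 (proof)] -/
theorem genApery_zero (r s : ℕ) : genApery r s 0 = 1 := by
  simp [genApery]

/-! ## Lucas's congruence on digits, in `ZMod p` -/

section Lucas

variable {p : ℕ} [hp : Fact p.Prime]

/-- Lucas: `C(kp+m, ip+j) ≡ C(k,i)·C(m,j) (mod p)` for digits `m, j < p` (Mathlib's Lucas step, recast in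
`ZMod p`). [cite: Gessel1982, Thm 1 (proof, «Lucas's congruence [6]»)] -/
theorem cast_choose_digit (k m i j : ℕ) (hm : m < p) (hj : j < p) :
    (((k * p + m).choose (i * p + j) : ℕ) : ZMod p)
      = ((k.choose i : ℕ) : ZMod p) * ((m.choose j : ℕ) : ZMod p) := by
  have h := Choose.choose_modEq_choose_mod_mul_choose_div_nat (n := k * p + m) (k := i * p + j) (p := p)
  have e1 : (k * p + m) % p = m := by rw [Nat.mul_add_mod', Nat.mod_eq_of_lt hm]
  have e2 : (k * p + m) / p = k := by
    rw [Nat.mul_comm, Nat.mul_add_div hp.out.pos, Nat.div_eq_of_lt hm, add_zero]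
  have e3 : (i * p + j) % p = j := by rw [Nat.mul_add_mod', Nat.mod_eq_of_lt hj]
  have e4 : (i * p + j) / p = i := by
    rw [Nat.mul_comm, Nat.mul_add_div hp.out.pos, Nat.div_eq_of_lt hj, add_zero]
  rw [e1, e2, e3, e4] at h
  rw [(ZMod.natCast_eq_natCast_iff _ _ _).mpr h]
  push_cast
  ring

/-- Gessel's «easily proved variant» of Lucas: `C(kp+m+ip+j, ip+j) ≡ C(k+i,i)·C(m+j,j) (mod p)` for digits
`m, j < p` (when `m + j ≥ p` both sides are `≡ 0`). [cite: Gessel1982, Thm 1 (proof)] -/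
theorem cast_choose_shift_digit (k m i j : ℕ) (hm : m < p) (hj : j < p) :
    (((k * p + m + (i * p + j)).choose (i * p + j) : ℕ) : ZMod p)
      = (((k + i).choose i : ℕ) : ZMod p) * (((m + j).choose j : ℕ) : ZMod p) := by
  by_cases hmj : m + j < p
  · have e : k * p + m + (i * p + j) = (k + i) * p + (m + j) := by ring
    rw [e, cast_choose_digit (k + i) (m + j) i j hmj hj]
  · push Not at hmj
    obtain ⟨t, ht⟩ : ∃ t, m + j = p + t := ⟨m + j - p, by omega⟩
    have htp : t < p := by omega
    have htj : t < j := by omega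
    have e : k * p + m + (i * p + j) = (k + i + 1) * p + t := by
      calc k * p + m + (i * p + j) = (k + i) * p + (m + j) := by ring
        _ = (k + i) * p + (p + t) := by rw [ht]
        _ = (k + i + 1) * p + t := by ring
    have e' : m + j = 1 * p + t := by rw [ht]; ring
    have e'' : j = 0 * p + j := by ring
    rw [e, cast_choose_digit (k + i + 1) t i j htp hj, Nat.choose_eq_zero_of_lt htj, e']
    conv_rhs => rw [e'', cast_choose_digit 1 t 0 j htp hj]
    rw [Nat.choose_eq_zero_of_lt htj]
    simp

/-- Splitting a sum over `range ((k+1)·p)` into `p`-blocks: `Σ_{x < (k+1)p} f x = Σ_{i ≤ k} Σ_{j < p} f(ip+j)`.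
[folklore] -/
private theorem sum_range_succ_mul {M : Type*} [AddCommMonoid M] (f : ℕ → M) (q : ℕ) :
    ∀ k : ℕ, ∑ x ∈ range ((k + 1) * q), f x = ∑ i ∈ range (k + 1), ∑ j ∈ range q, f (i * q + j)
  | 0 => by simp
  | k + 1 => by
      rw [Finset.sum_range_succ (fun i => ∑ j ∈ range q, f (i * q + j)) (k + 1),
        ← sum_range_succ_mul f q k]
      have e : (k + 1 + 1) * q = (k + 1) * q + q := by ring
      rw [e, Finset.sum_range_add]

/-- **Lucas congruence for `A_{r,s}`, one digit** (Gessel's computation): for a prime `p`, `0 ≤ m < p` and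
`r ≥ 1`, `A_{r,s}(kp + m) ≡ A_{r,s}(k) · A_{r,s}(m) (mod p)`.
[cite: Gessel1982, Thm 1 (proof: «a_{m+pn} ≡ a_m a_n»)] -/
theorem genApery_modEq_mul (r s k m : ℕ) (hr : 0 < r) (hm : m < p) :
    genApery r s (k * p + m) ≡ genApery r s k * genApery r s m [MOD p] := by
  rw [← ZMod.natCast_eq_natCast_iff]
  have hr' : r ≠ 0 := Nat.pos_iff_ne_zero.mp hr
  -- the summand of `A_{r,s}(kp+m)`, cast to `ZMod p`
  set f : ℕ → ZMod p := fun x =>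
    (((k * p + m).choose x : ℕ) : ZMod p) ^ r * (((k * p + m + x).choose x : ℕ) : ZMod p) ^ s with hf
  set g : ℕ → ZMod p := fun i =>
    ((k.choose i : ℕ) : ZMod p) ^ r * (((k + i).choose i : ℕ) : ZMod p) ^ s with hg
  set h : ℕ → ZMod p := fun j =>
    ((m.choose j : ℕ) : ZMod p) ^ r * (((m + j).choose j : ℕ) : ZMod p) ^ s with hh
  have hL : ((genApery r s (k * p + m) : ℕ) : ZMod p) = ∑ x ∈ range (k * p + m + 1), f x := by
    simp [genApery, hf]
  have hK : ((genApery r s k : ℕ) : ZMod p) = ∑ i ∈ range (k + 1), g i := by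
    simp [genApery, hg]
  have hM : ((genApery r s m : ℕ) : ZMod p) = ∑ j ∈ range (m + 1), h j := by
    simp [genApery, hh]
  -- step 1: extend the sum to the full block range `(k+1)p` (the extra binomials vanish)
  have h1 : ∑ x ∈ range (k * p + m + 1), f x = ∑ x ∈ range ((k + 1) * p), f x := by
    apply Finset.sum_subset
    · intro x hx
      simp only [mem_range] at hx ⊢
      nlinarith
    · intro x hx hx'
      simp only [mem_range, not_lt] at hx hx'
      have : (k * p + m).choose x = 0 := Nat.choose_eq_zero_of_lt (by omega)
      simp [hf, this, hr']
  -- step 2: split into digit blocks and identify each summand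
  have h2 : ∑ x ∈ range ((k + 1) * p), f x = ∑ i ∈ range (k + 1), ∑ j ∈ range p, g i * h j := by
    rw [sum_range_succ_mul f p k]
    refine Finset.sum_congr rfl fun i _ => Finset.sum_congr rfl fun j hj => ?_
    simp only [mem_range] at hj
    simp only [hf, hg, hh]
    rw [cast_choose_digit k m i j hm hj, cast_choose_shift_digit k m i j hm hj]
    ring
  -- step 3: the inner sum over a full digit block is `A_{r,s}(m)` (binomials `C(m,j)`, `j > m`, vanish)
  have h3 : ∑ j ∈ range p, h j = ∑ j ∈ range (m + 1), h j := by
    symm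
    apply Finset.sum_subset
    · intro x hx
      simp only [mem_range] at hx ⊢
      omega
    · intro x _ hx'
      simp only [mem_range, not_lt] at hx'
      have : m.choose x = 0 := Nat.choose_eq_zero_of_lt (by omega)
      simp [hh, this, hr']
  rw [hL, h1, h2, ← Finset.sum_mul_sum, h3, ← hK, ← hM, Nat.cast_mul]

/-- **Lucas congruence for `A_{r,s}`** (all digits): for a prime `p` and `r ≥ 1`,
`A_{r,s}(n) ≡ ∏_{d} A_{r,s}(d) (mod p)`, the product over the base-`p` digits `d` of `n`.
[cite: Gessel1982, Thm 1 (statement, for a_n = A_{2,2}; «follows by induction»)] -/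
theorem genApery_modEq_prod_digits (r s : ℕ) (hr : 0 < r) (n : ℕ) :
    genApery r s n ≡ ((Nat.digits p n).map (genApery r s)).prod [MOD p] := by
  induction n using Nat.strong_induction_on with
  | _ n ih =>
    rcases Nat.eq_zero_or_pos n with hn | hn
    · subst hn
      simp [genApery_zero, Nat.ModEq.refl]
    · rw [Nat.digits_def' hp.out.one_lt hn, List.map_cons, List.prod_cons]
      have hsplit : n = n / p * p + n % p := (Nat.div_add_mod' n p).symm
      have hstep := genApery_modEq_mul (p := p) r s (n / p) (n % p) hr (Nat.mod_lt n hp.out.pos)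
      rw [← hsplit] at hstep
      have hih := ih (n / p) (Nat.div_lt_self hn hp.out.one_lt)
      calc genApery r s n ≡ genApery r s (n / p) * genApery r s (n % p) [MOD p] := hstep
        _ ≡ ((Nat.digits p (n / p)).map (genApery r s)).prod * genApery r s (n % p) [MOD p] :=
            hih.mul_right _
        _ = genApery r s (n % p) * ((Nat.digits p (n / p)).map (genApery r s)).prod := by ring

/-! ## Gessel's Theorem 1 (Apéry numbers) and the `ζ(2)` companion -/

/-- **Gessel 1982, Theorem 1 (one digit)**: for every prime `p` and `0 ≤ m < p`,
`a_{kp+m} ≡ a_k · a_m (mod p)` for the Apéry numbers `a_n = Σ_k C(n,k)² C(n+k,k)²`.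
[cite: Gessel1982, Thm 1 (proof)] -/
theorem aperyNumber_modEq_mul (k m : ℕ) (hm : m < p) :
    AperyNumbers.aperyNumber (k * p + m)
      ≡ AperyNumbers.aperyNumber k * AperyNumbers.aperyNumber m [MOD p] := by
  simpa only [genApery_two_two] using genApery_modEq_mul (p := p) 2 2 k m (by norm_num) hm

/-- **Gessel 1982, Theorem 1, as printed**: for every prime `p`,
`a_{n₀ + p n₁ + ⋯ + p^s n_s} ≡ a_{n₀} a_{n₁} ⋯ a_{n_s} (mod p)` (`0 ≤ nᵢ < p` the base-`p` digits of `n`),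
for the Apéry numbers. [cite: Gessel1982, Thm 1] -/
theorem aperyNumber_modEq_prod_digits (n : ℕ) :
    AperyNumbers.aperyNumber n ≡ ((Nat.digits p n).map AperyNumbers.aperyNumber).prod [MOD p] := by
  have h := genApery_modEq_prod_digits (p := p) 2 2 (by norm_num) n
  have e : genApery 2 2 = AperyNumbers.aperyNumber := funext genApery_two_two
  simpa only [e] using h

/-- Lucas congruence, one digit, for Apéry's `ζ(2)` numbers `A_{2,1}(n) = Σ_k C(n,k)² C(n+k,k)`:
`b_{kp+m} ≡ b_k · b_m (mod p)` for `m < p`. [cite: MalikStraub2016, §3 (A_{r,s} satisfy Lucas congruences)] -/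
theorem apery2Number_modEq_mul (k m : ℕ) (hm : m < p) :
    AperyNumbersZetaTwo.apery2Number (k * p + m)
      ≡ AperyNumbersZetaTwo.apery2Number k * AperyNumbersZetaTwo.apery2Number m [MOD p] := by
  simpa only [genApery_two_one] using genApery_modEq_mul (p := p) 2 1 k m (by norm_num) hm

/-- Lucas congruence (all digits) for Apéry's `ζ(2)` numbers `A_{2,1}`.
[cite: MalikStraub2016, §3 (A_{r,s} satisfy Lucas congruences)] -/
theorem apery2Number_modEq_prod_digits (n : ℕ) :
    AperyNumbersZetaTwo.apery2Number n
      ≡ ((Nat.digits p n).map AperyNumbersZetaTwo.apery2Number).prod [MOD p] := by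
  have h := genApery_modEq_prod_digits (p := p) 2 1 (by norm_num) n
  have e : genApery 2 1 = AperyNumbersZetaTwo.apery2Number := funext genApery_two_one
  simpa only [e] using h

end Lucas

end Literature.Combinatorics.Enumerative.AperyLucasCongruences
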